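import Literature.Computability.QuantumComplexity.ForrelationThm25Lexer
import Literature.Computability.Cryptography.QuantumCircuitDescFP
import HarnessLib

/-!
# Uniformity of the Hadamard-gadget family, I: the lexer of circuit descriptions

Topic `Literature/Computability/QuantumComplexity`; first of the files proving that the compiled
post-selected IQP family `HGadget.gadgetFamily F` (`HadamardGadgetFamily.lean`; M. J. Bremner,
R. Jozsa, D. J. Shepherd, Proc. R. Soc. A 467 (2011) = arXiv:1005.1407, proof of Thm. 1: "the
mapping `w → C_w` is computable in classical poly(n) time", Def. 1) is polynomial-time uniform
whenever the given Clifford+T family `F` is. The description of the compiled circuit is computed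
from the pair `⟨z, F.descFn z⟩` (`|z| = n`; `QCircuitFamily.descFn`, `QuantumCircuitDescFP.lean`) by
the composite of

* a **finite-state transducer** (this file; `FST`, `Transducers.lean`) lexing
  `boolPair z (boolPair (bin n) (boolPair 1ᵐ (encList (gate codes))))` into the stream
  `1ⁿ 0 (1 b₀)(1 b₁)⋯ 0 1ᵐ 0` (unary `n`, the bits `bᵢ` of the binary numeral of `n` each announced
  by a `1`, unary `m` — the one-bit formats a stack program consumes with one loop each) followed,
  per gate and in postfix order, by three-bit tokens: the bits of its wire numerals (each numeral
  ended by a separator) and its kind (`H`, `S`, `T`, `CNOT`; oracle or malformed gates: `tokBAD`);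
* a structured stack program interpreting that stream (sequel files).

The gate-list part of the transducer is that of `ForrelationThm25Lexer.lean` (same circuit code
`QCircuit.encode`, same four symbol numerals `[]`, `1`, `01`, `11`), whose cells `Thm25Lex.Cell`,
symbol accumulator `Thm25Lex.SymV` and tokens are reused; the prefix phases are new. Main result:
`HGadget.Lex.eval_input` — on `boolPair z (F.descFn z)` the lexer outputs `HGadget.Lex.stream F z`.

## References

* M. J. Bremner, R. Jozsa, D. J. Shepherd, Proc. R. Soc. A 467 (2011) 459–472, Def. 1 and Thm. 1.
* S. Arora, B. Barak, *Computational Complexity: A Modern Approach*, CUP 2009, §0.1 (pairing,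
  binary numerals), §1.3, §6.1 (circuit codes).
* J. E. Hopcroft, J. D. Ullman, *Introduction to Automata Theory, Languages, and Computation*,
  Addison-Wesley 1979, §2.7 (Mealy machines).
-/

namespace Literature.Computability.QuantumComplexity

open _root_.Computability Complexity Cryptography Thm25Lex

namespace HGadget

namespace Lex

/-! ### Tokens -/

/-- Token: a separator (the end-of-numeral token of the gate part). [folklore] -/
def tokSEP : List Bool := tokWEND
/-- Token: an oracle gate or a malformed gate. [folklore] -/
def tokBAD : List Bool := tokKOR
/-- Token: a Hadamard gate (symbol `0`). [folklore] -/
def tokH : List Bool := tokKH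
/-- Token: an `S` gate (symbol `1`). [folklore] -/
def tokS : List Bool := tokKZ
/-- Token: a `T` gate (symbol `2`). [folklore] -/
def tokT : List Bool := tokKCZ
/-- Token: a `CNOT` gate (symbol `3`). [folklore] -/
def tokCNOT : List Bool := tokKCCZ

/-- The kind token of a Clifford+T gate symbol. [folklore] -/
def kindTokOf : CliffordTOp → List Bool
  | .H => tokH
  | .S => tokS
  | .T => tokT
  | .CNOT => tokCNOT

/-- **The token block of a gate** (postfix: the wire numerals, each bit by bit and ended by a
separator, then the kind). [cite: AroraBarak2009, §6.1 (descriptions of circuits)] -/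
noncomputable def gateToks {N : ℕ} : QGate cliffordT N → List Bool
  | .gate g e => ((List.ofFn fun i => (e i : ℕ)).flatMap wireTok) ++ kindTokOf g
  | .oracle _ _ => tokBAD

/-- The announced bits of a numeral: `(1 b₀)(1 b₁)⋯`. [folklore] -/
def annBits (u : List Bool) : List Bool := u.flatMap fun b => [true, b]

/-- `annBits` of nil. [folklore] -/
@[simp] theorem annBits_nil : annBits [] = [] := rfl
/-- `annBits` of cons. [folklore] -/
@[simp] theorem annBits_cons (b : Bool) (u : List Bool) : annBits (b :: u) = true :: b :: annBits u := rfl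

/-- **The stream of the input `⟨z, F.descFn z⟩`**: `1ⁿ 0`, the announced bits of `bin n` and a `0`,
`1ᵐ 0`, then the gate blocks. [cite: AroraBarak2009, §6.1] -/
noncomputable def stream (F : QCircuitFamily cliffordT) (z : List Bool) : List Bool :=
  List.replicate z.length true ++ false :: (annBits (encodeNat z.length) ++ false ::
    (List.replicate (F.ancillas z.length) true ++ false :: (F.circ z.length).gates.flatMap gateToks))

/-! ### The transducer -/

/-- Phases: the cells of `z`, the numeral of `n`, the unary numeral of `m`, then the gate-list
phases of `ForrelationThm25Lexer.lean` (gate list, symbol, arity, wires, oracle skipping) and the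
dead phase. [folklore] -/
inductive Ph
  | pz | pn | pm | gl | sym | ar | wi | osk | dead
  deriving DecidableEq, Fintype

/-- The state of the lexer: phase, pending first bit of a cell, pending first cell of a
four-bit group, symbol accumulator. [folklore] -/
structure LS where
  /-- phase -/
  ph : Ph
  /-- pending first bit of the current cell -/
  hb : Option Bool
  /-- pending first cell of the current group -/
  hc : Option Bool
  /-- symbol accumulator -/
  sv : SymV
  deriving DecidableEq, Fintype

/-- The kind token emitted at the end of a gate: by the accumulated symbol if the gate reached
its wire list, `tokBAD` otherwise. [folklore] -/
def kindTok (ph : Ph) (sv : SymV) : List Bool := if ph = Ph.wi then sv.tok else tokBAD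

/-- A data bit inside a gate: a symbol bit, an arity bit (ignored), a wire bit (emitted), or a
bit of an oracle gate (ignored). [folklore] -/
def dataStep (ph : Ph) (sv : SymV) (b : Bool) : LS × List Bool :=
  match ph with
  | .sym => (⟨.sym, none, none, sv.push b⟩, [])
  | .wi => (⟨.wi, none, none, sv⟩, tokB b)
  | ph => (⟨ph, none, none, sv⟩, [])

/-- A group separator `0011` inside a gate: next field. [folklore] -/
def gsepStep (ph : Ph) (sv : SymV) : LS × List Bool :=
  match ph with
  | .sym => (⟨.ar, none, none, sv⟩, [])
  | .ar => (⟨.wi, none, none, sv⟩, [])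
  | .wi => (⟨.wi, none, none, sv⟩, tokSEP)
  | ph => (⟨ph, none, none, sv⟩, [])

/-- Processing a complete cell (the pending bit already consumed). The three prefix phases: every
cell of `z` is a `1`, the cells of `bin n` are announced bits `1 b`, the cells of `1ᵐ` are `1`s, each
field ended by a `0` at the pair separator. [folklore] -/
def cellStep (ph : Ph) (hc : Option Bool) (sv : SymV) (c : Cell) : LS × List Bool :=
  match ph with
  | .pz =>
    match c with
    | .c0 => (⟨.pz, none, none, sv⟩, [true])
    | .c1 => (⟨.pz, none, none, sv⟩, [true])
    | .sep => (⟨.pn, none, none, sv⟩, [false])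
    | .bad => (⟨.dead, none, none, sv⟩, [])
  | .pn =>
    match c with
    | .c0 => (⟨.pn, none, none, sv⟩, [true, false])
    | .c1 => (⟨.pn, none, none, sv⟩, [true, true])
    | .sep => (⟨.pm, none, none, sv⟩, [false])
    | .bad => (⟨.dead, none, none, sv⟩, [])
  | .pm =>
    match c with
    | .c1 => (⟨.pm, none, none, sv⟩, [true])
    | .sep => (⟨.gl, none, none, sv⟩, [false])
    | _ => (⟨.dead, none, none, sv⟩, [])
  | .gl =>
    match c with
    | .c0 => (⟨.sym, none, none, .s0⟩, [])
    | .c1 => (⟨.osk, none, none, sv⟩, [])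
    | _ => (⟨.dead, none, none, sv⟩, [])
  | .dead => (⟨.dead, none, none, sv⟩, [])
  | ph =>
    match hc, c with
    | none, .sep => (⟨.gl, none, none, sv⟩, kindTok ph sv)
    | none, .c0 => (⟨ph, none, some false, sv⟩, [])
    | none, .c1 => (⟨ph, none, some true, sv⟩, [])
    | none, .bad => (⟨.dead, none, none, sv⟩, [])
    | some false, .c0 => dataStep ph sv false
    | some true, .c1 => dataStep ph sv true
    | some false, .c1 => gsepStep ph sv
    | some _, _ => (⟨.dead, none, none, sv⟩, [])

/-- One input bit: store the first bit of a cell, or complete the cell. [folklore] -/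
def step (s : LS) (x : Bool) : LS × List Bool :=
  match s.hb with
  | none => (⟨s.ph, some x, s.hc, s.sv⟩, [])
  | some y => cellStep s.ph s.hc s.sv (cellOf y x)

/-- **The lexer** (no front word, body always kept). [cite: AroraBarak2009, §6.1 (descriptions of circuits)] -/
def lexT : FST LS Bool Bool where
  init := ⟨.pz, none, none, .s0⟩
  step := step
  front _ := []
  keep _ := true

/-- The lexer is a polynomial-time string function. [cite: AroraBarak2009, §1.3] -/
theorem lexT_eval_mem_FP : lexT.eval ∈ FP := lexT.polyTimeComputable_eval

/-! ### Running the lexer: cells and segments -/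

/-- Two input bits form a cell. [folklore] -/
theorem run_cell (ph : Ph) (hc : Option Bool) (sv : SymV) (y x : Bool) (l : List Bool) :
    lexT.run ⟨ph, none, hc, sv⟩ (y :: x :: l) =
      ((lexT.run (cellStep ph hc sv (cellOf y x)).1 l).1,
        (cellStep ph hc sv (cellOf y x)).2 ++ (lexT.run (cellStep ph hc sv (cellOf y x)).1 l).2) := by
  rfl

/-- The cells of `z` are `1`s. [folklore] -/
theorem run_pz_rep (sv : SymV) (z l : List Bool) :
    lexT.run ⟨.pz, none, none, sv⟩ (rep 2 z ++ l) =
      ((lexT.run ⟨.pz, none, none, sv⟩ l).1, List.replicate z.length true ++ (lexT.run ⟨.pz, none, none, sv⟩ l).2) := by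
  induction z with
  | nil => simp
  | cons b z ih =>
    rw [rep_cons, List.append_assoc]
    change lexT.run ⟨.pz, none, none, sv⟩ (b :: b :: (rep 2 z ++ l)) = _
    rw [run_cell]
    cases b <;>
    · change ((lexT.run ⟨.pz, none, none, sv⟩ (rep 2 z ++ l)).1, [true] ++ (lexT.run ⟨.pz, none, none, sv⟩ (rep 2 z ++ l)).2) = _
      rw [ih, List.length_cons, List.replicate_succ]; rfl

/-- The separator after `z`. [folklore] -/
theorem run_pz_sep (sv : SymV) (l : List Bool) :
    lexT.run ⟨.pz, none, none, sv⟩ (false :: true :: l) =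
      ((lexT.run ⟨.pn, none, none, sv⟩ l).1, false :: (lexT.run ⟨.pn, none, none, sv⟩ l).2) := by
  rw [run_cell]; rfl

/-- The cells of the numeral of `n` are announced bits. [folklore] -/
theorem run_pn_rep (sv : SymV) (u l : List Bool) :
    lexT.run ⟨.pn, none, none, sv⟩ (rep 2 u ++ l) =
      ((lexT.run ⟨.pn, none, none, sv⟩ l).1, annBits u ++ (lexT.run ⟨.pn, none, none, sv⟩ l).2) := by
  induction u with
  | nil => simp
  | cons b u ih =>
    rw [rep_cons, List.append_assoc]
    change lexT.run ⟨.pn, none, none, sv⟩ (b :: b :: (rep 2 u ++ l)) = _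
    rw [run_cell]
    cases b <;>
    · change ((lexT.run ⟨.pn, none, none, sv⟩ (rep 2 u ++ l)).1, [true, _] ++ (lexT.run ⟨.pn, none, none, sv⟩ (rep 2 u ++ l)).2) = _
      rw [ih, annBits_cons]; rfl

/-- The separator after the numeral of `n`. [folklore] -/
theorem run_pn_sep (sv : SymV) (l : List Bool) :
    lexT.run ⟨.pn, none, none, sv⟩ (false :: true :: l) =
      ((lexT.run ⟨.pm, none, none, sv⟩ l).1, false :: (lexT.run ⟨.pm, none, none, sv⟩ l).2) := by
  rw [run_cell]; rfl

/-- The unary numeral of `m` is copied. [folklore] -/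
theorem run_pm_replicate (sv : SymV) (m : ℕ) (l : List Bool) :
    lexT.run ⟨.pm, none, none, sv⟩ (rep 2 (List.replicate m true) ++ l) =
      ((lexT.run ⟨.pm, none, none, sv⟩ l).1, List.replicate m true ++ (lexT.run ⟨.pm, none, none, sv⟩ l).2) := by
  induction m with
  | zero => simp
  | succ m ih =>
    rw [List.replicate_succ, rep_cons, List.append_assoc]
    change lexT.run ⟨.pm, none, none, sv⟩ (true :: true :: (rep 2 (List.replicate m true) ++ l)) = _
    rw [run_cell]
    change ((lexT.run ⟨.pm, none, none, sv⟩ (rep 2 (List.replicate m true) ++ l)).1,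
      [true] ++ (lexT.run ⟨.pm, none, none, sv⟩ (rep 2 (List.replicate m true) ++ l)).2) = _
    rw [ih]; rfl

/-- The separator after the unary numeral of `m`. [folklore] -/
theorem run_pm_sep (sv : SymV) (l : List Bool) :
    lexT.run ⟨.pm, none, none, sv⟩ (false :: true :: l) =
      ((lexT.run ⟨.gl, none, none, sv⟩ l).1, false :: (lexT.run ⟨.gl, none, none, sv⟩ l).2) := by
  rw [run_cell]; rfl

/-- The tag cell of a proper gate. [folklore] -/
theorem run_gl_gate (sv : SymV) (l : List Bool) :
    lexT.run ⟨.gl, none, none, sv⟩ (false :: false :: l) = lexT.run ⟨.sym, none, none, .s0⟩ l := by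
  rw [run_cell]; rfl

/-- The tag cell of an oracle gate. [folklore] -/
theorem run_gl_oracle (sv : SymV) (l : List Bool) :
    lexT.run ⟨.gl, none, none, sv⟩ (true :: true :: l) = lexT.run ⟨.osk, none, none, sv⟩ l := by
  rw [run_cell]; rfl

/-- A data bit in the symbol phase updates the accumulator. [folklore] -/
theorem run_sym_data (sv : SymV) (b : Bool) (l : List Bool) :
    lexT.run ⟨.sym, none, none, sv⟩ (b :: b :: b :: b :: l) = lexT.run ⟨.sym, none, none, sv.push b⟩ l := by
  rw [run_cell]; cases b <;> rfl

/-- A data bit in the arity phase is ignored. [folklore] -/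
theorem run_ar_data (sv : SymV) (b : Bool) (l : List Bool) :
    lexT.run ⟨.ar, none, none, sv⟩ (b :: b :: b :: b :: l) = lexT.run ⟨.ar, none, none, sv⟩ l := by
  rw [run_cell]; cases b <;> rfl

/-- A data bit while skipping an oracle gate is ignored. [folklore] -/
theorem run_osk_data (sv : SymV) (b : Bool) (l : List Bool) :
    lexT.run ⟨.osk, none, none, sv⟩ (b :: b :: b :: b :: l) = lexT.run ⟨.osk, none, none, sv⟩ l := by
  rw [run_cell]; cases b <;> rfl

/-- A data bit in the wire phase is emitted as a token. [folklore] -/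
theorem run_wi_data (sv : SymV) (b : Bool) (l : List Bool) :
    lexT.run ⟨.wi, none, none, sv⟩ (b :: b :: b :: b :: l) =
      ((lexT.run ⟨.wi, none, none, sv⟩ l).1, tokB b ++ (lexT.run ⟨.wi, none, none, sv⟩ l).2) := by
  rw [run_cell]; cases b <;> rfl

/-- The whole symbol numeral. [folklore] -/
theorem run_sym_rep (sv : SymV) (u : List Bool) (l : List Bool) :
    lexT.run ⟨.sym, none, none, sv⟩ (rep 4 u ++ l) = lexT.run ⟨.sym, none, none, u.foldl SymV.push sv⟩ l := by
  induction u generalizing sv with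
  | nil => rfl
  | cons b u ih =>
    rw [rep_cons, List.append_assoc]
    change lexT.run ⟨.sym, none, none, sv⟩ (b :: b :: b :: b :: (rep 4 u ++ l)) = _
    rw [run_sym_data, ih]; rfl

/-- A doubled-doubled segment in the arity phase is skipped. [folklore] -/
theorem run_ar_rep (sv : SymV) (u : List Bool) (l : List Bool) :
    lexT.run ⟨.ar, none, none, sv⟩ (rep 4 u ++ l) = lexT.run ⟨.ar, none, none, sv⟩ l := by
  induction u with
  | nil => rfl
  | cons b u ih =>
    rw [rep_cons, List.append_assoc]
    change lexT.run ⟨.ar, none, none, sv⟩ (b :: b :: b :: b :: (rep 4 u ++ l)) = _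
    rw [run_ar_data, ih]

/-- A doubled-doubled segment of an oracle gate is skipped. [folklore] -/
theorem run_osk_rep (sv : SymV) (u : List Bool) (l : List Bool) :
    lexT.run ⟨.osk, none, none, sv⟩ (rep 4 u ++ l) = lexT.run ⟨.osk, none, none, sv⟩ l := by
  induction u with
  | nil => rfl
  | cons b u ih =>
    rw [rep_cons, List.append_assoc]
    change lexT.run ⟨.osk, none, none, sv⟩ (b :: b :: b :: b :: (rep 4 u ++ l)) = _
    rw [run_osk_data, ih]

/-- A wire numeral is emitted bit by bit. [folklore] -/
theorem run_wi_rep (sv : SymV) (u : List Bool) (l : List Bool) :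
    lexT.run ⟨.wi, none, none, sv⟩ (rep 4 u ++ l) =
      ((lexT.run ⟨.wi, none, none, sv⟩ l).1, bitsTok u ++ (lexT.run ⟨.wi, none, none, sv⟩ l).2) := by
  induction u with
  | nil => simp
  | cons b u ih =>
    rw [rep_cons, List.append_assoc]
    change lexT.run ⟨.wi, none, none, sv⟩ (b :: b :: b :: b :: (rep 4 u ++ l)) = _
    rw [run_wi_data, ih, bitsTok_cons, List.append_assoc]

/-- The group separator ends the symbol field. [folklore] -/
theorem run_sym_gsep (sv : SymV) (l : List Bool) :
    lexT.run ⟨.sym, none, none, sv⟩ (false :: false :: true :: true :: l) = lexT.run ⟨.ar, none, none, sv⟩ l := by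
  rw [run_cell]; rfl

/-- The group separator ends the arity field. [folklore] -/
theorem run_ar_gsep (sv : SymV) (l : List Bool) :
    lexT.run ⟨.ar, none, none, sv⟩ (false :: false :: true :: true :: l) = lexT.run ⟨.wi, none, none, sv⟩ l := by
  rw [run_cell]; rfl

/-- The group separator inside an oracle gate is skipped. [folklore] -/
theorem run_osk_gsep (sv : SymV) (l : List Bool) :
    lexT.run ⟨.osk, none, none, sv⟩ (false :: false :: true :: true :: l) = lexT.run ⟨.osk, none, none, sv⟩ l := by
  rw [run_cell]; rfl

/-- The group separator after a wire numeral is the separator token. [folklore] -/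
theorem run_wi_gsep (sv : SymV) (l : List Bool) :
    lexT.run ⟨.wi, none, none, sv⟩ (false :: false :: true :: true :: l) =
      ((lexT.run ⟨.wi, none, none, sv⟩ l).1, tokSEP ++ (lexT.run ⟨.wi, none, none, sv⟩ l).2) := by
  rw [run_cell]; rfl

/-- The pair separator `01` at a group boundary ends the gate: the kind token. [folklore] -/
theorem run_wi_end (sv : SymV) (l : List Bool) :
    lexT.run ⟨.wi, none, none, sv⟩ (false :: true :: l) =
      ((lexT.run ⟨.gl, none, none, sv⟩ l).1, sv.tok ++ (lexT.run ⟨.gl, none, none, sv⟩ l).2) := by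
  rw [run_cell]; rfl

/-- The pair separator `01` at a group boundary ends an oracle gate. [folklore] -/
theorem run_osk_end (sv : SymV) (l : List Bool) :
    lexT.run ⟨.osk, none, none, sv⟩ (false :: true :: l) =
      ((lexT.run ⟨.gl, none, none, sv⟩ l).1, tokBAD ++ (lexT.run ⟨.gl, none, none, sv⟩ l).2) := by
  rw [run_cell]; rfl

/-! ### Running the lexer: fields, gates, the whole input -/

/-- The list of wire numerals of a gate is emitted as wire tokens. [folklore] -/
theorem run_wi_wires (sv : SymV) (ws : List ℕ) (l : List Bool) :
    lexT.run ⟨.wi, none, none, sv⟩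
        ((ws.flatMap fun w => rep 4 (encodeNat w) ++ [false, false, true, true]) ++ l) =
      ((lexT.run ⟨.wi, none, none, sv⟩ l).1, ws.flatMap wireTok ++ (lexT.run ⟨.wi, none, none, sv⟩ l).2) := by
  induction ws with
  | nil => simp
  | cons w ws ih =>
    rw [List.flatMap_cons, List.append_assoc, List.append_assoc, run_wi_rep]
    simp only [List.cons_append, List.nil_append]
    rw [run_wi_gsep, ih, List.flatMap_cons, wireTok]
    simp only [List.append_assoc]
    rfl

/-- The wire numerals of an oracle gate are skipped. [folklore] -/
theorem run_osk_wires (sv : SymV) (ws : List ℕ) (l : List Bool) :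
    lexT.run ⟨.osk, none, none, sv⟩
        ((ws.flatMap fun w => rep 4 (encodeNat w) ++ [false, false, true, true]) ++ l) =
      lexT.run ⟨.osk, none, none, sv⟩ l := by
  induction ws with
  | nil => simp
  | cons w ws ih =>
    rw [List.flatMap_cons, List.append_assoc, List.append_assoc, run_osk_rep]
    simp only [List.cons_append, List.nil_append]
    rw [run_osk_gsep, ih]

/-- The symbol numerals of the four Clifford+T gate symbols drive the accumulator to the right kind
(`H = 0 = []`, `S = 1`, `T = 01`, `CNOT = 11`). [folklore] -/
theorem tok_foldl_encode (g : CliffordTOp) :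
    ((encodeNat (Encodable.encode g)).foldl SymV.push .s0).tok = kindTokOf g := by
  cases g <;> rfl

/-- **One proper gate**: its doubled code followed by the pair separator lexes to its token block,
and the lexer is back at the gate list. [cite: AroraBarak2009, §6.1 (descriptions of circuits)] -/
theorem run_gl_gateCode {N : ℕ} (sv : SymV) (g : CliffordTOp) (e : Fin (cliffordT.arity g) ↪ Fin N) (l : List Bool) :
    ∃ sv' : SymV, lexT.run ⟨.gl, none, none, sv⟩
        (rep 2 (QGate.encode (QGate.gate (G := cliffordT) (n := N) g e)) ++ [false, true] ++ l) =
      ((lexT.run ⟨.gl, none, none, sv'⟩ l).1,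
        gateToks (QGate.gate (G := cliffordT) (n := N) g e) ++ (lexT.run ⟨.gl, none, none, sv'⟩ l).2) := by
  refine ⟨(encodeNat (Encodable.encode g)).foldl SymV.push .s0, ?_⟩
  have hcode : QGate.encode (QGate.gate (G := cliffordT) (n := N) g e) = false :: boolPair (encodeNat (Encodable.encode g))
      (encodingListNatBool.encode (List.ofFn fun i => (e i : ℕ))) := rfl
  rw [hcode, rep_cons, rep_two_boolPair, rep_two_encode_wires]
  simp only [List.replicate, List.cons_append, List.append_assoc, List.nil_append]
  rw [run_gl_gate, run_sym_rep, run_sym_gsep, run_ar_rep, run_ar_gsep, run_wi_wires, run_wi_end, tok_foldl_encode,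
    gateToks, List.append_assoc]

/-- **One oracle gate** lexes to the single token `tokBAD`. [cite: AroraBarak2009, §6.1 (descriptions of circuits)] -/
theorem run_gl_oracleCode {N : ℕ} (sv : SymV) (k : ℕ) (e : Fin (k + 1) ↪ Fin N) (l : List Bool) :
    lexT.run ⟨.gl, none, none, sv⟩ (rep 2 (QGate.encode (QGate.oracle (G := cliffordT) k e)) ++ [false, true] ++ l) =
      ((lexT.run ⟨.gl, none, none, sv⟩ l).1,
        gateToks (QGate.oracle (G := cliffordT) k e) ++ (lexT.run ⟨.gl, none, none, sv⟩ l).2) := by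
  have hcode : QGate.encode (QGate.oracle (G := cliffordT) k e) = true :: boolPair (encodeNat k)
      (encodingListNatBool.encode (List.ofFn fun i => (e i : ℕ))) := rfl
  rw [hcode, rep_cons, rep_two_boolPair, rep_two_encode_wires]
  simp only [List.replicate, List.cons_append, List.append_assoc, List.nil_append]
  rw [run_gl_oracle, run_osk_rep, run_osk_gsep, run_osk_rep, run_osk_gsep, run_osk_wires, run_osk_end, gateToks]

/-- **A whole gate list** lexes to the concatenation of the token blocks. [cite: AroraBarak2009, §6.1 (descriptions of circuits)] -/
theorem run_gl_gates {N : ℕ} (gs : List (QGate cliffordT N)) :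
    ∀ sv : SymV, ∃ sv' : SymV, lexT.run ⟨.gl, none, none, sv⟩
        (gs.flatMap fun g => rep 2 (QGate.encode g) ++ [false, true]) =
      (⟨.gl, none, none, sv'⟩, gs.flatMap gateToks) := by
  induction gs with
  | nil => intro sv; exact ⟨sv, rfl⟩
  | cons g gs ih =>
    intro sv
    rw [List.flatMap_cons, List.flatMap_cons]
    cases g with
    | gate g e =>
      obtain ⟨sv₁, h₁⟩ := run_gl_gateCode sv g e (gs.flatMap fun g => rep 2 (QGate.encode g) ++ [false, true])
      obtain ⟨sv₂, h₂⟩ := ih sv₁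
      exact ⟨sv₂, by rw [h₁, h₂]⟩
    | oracle k e =>
      obtain ⟨sv₂, h₂⟩ := ih sv
      refine ⟨sv₂, ?_⟩
      cases k with
      | zero => rw [run_gl_oracleCode sv 0 e, h₂]
      | succ k => rw [run_gl_oracleCode sv (k + 1) e, h₂]

/-- The input of the machine: `⟨z, F.descFn z⟩` as a doubled stream. [folklore] -/
theorem input_eq (F : QCircuitFamily cliffordT) (z : List Bool) :
    boolPair z (F.descFn z) = rep 2 z ++ (false :: true :: (rep 2 (encodeNat z.length) ++ (false :: true ::
      (rep 2 (List.replicate (F.ancillas z.length) true) ++ (false :: true ::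
        ((F.circ z.length).gates.flatMap fun g => rep 2 (QGate.encode g) ++ [false, true])))))) := by
  rw [QCircuitFamily.descFn_eq, boolPair_eq_rep, boolPair_eq_rep, boolPair_eq_rep, Thm25Lex.unaryEncodeNat_eq_replicate,
    QCircuit.encode_eq_encList, Com.encList_eq_flatMap, List.flatMap_map]
  simp only [List.append_assoc, List.cons_append, List.nil_append]
  rfl

/-- **The lexer on the input `⟨z, F.descFn z⟩`** outputs the token stream `stream F z`.
[cite: BremnerJozsaShepherdPRSA2011, Def. 1 (the description `w ↦ C_w`)] -/
theorem eval_input (F : QCircuitFamily cliffordT) (z : List Bool) :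
    lexT.eval (boolPair z (F.descFn z)) = stream F z := by
  obtain ⟨sv', h⟩ := run_gl_gates (F.circ z.length).gates SymV.s0
  rw [FST.eval, input_eq]
  change List.nil ++ (if true = true then (lexT.run ⟨.pz, none, none, .s0⟩ _).2 else []) = _
  rw [if_pos rfl, List.nil_append, run_pz_rep, run_pz_sep, run_pn_rep, run_pn_sep, run_pm_replicate, run_pm_sep, h,
    stream]

end Lex

end HGadget

end Literature.Computability.QuantumComplexity
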